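import Literature.Geometry.Riemannian.EigenvaluePinchingSphereProofs
import Literature.Geometry.Riemannian.RicciFlowScalarCurvatureComparison
import HarnessLib

/-!
# The Bochner inequality under a lower Ricci bound

From the tree's pointwise Bochner formula (`dalembertian_gradSq_eq`,
`Δ|∇u|² = 2|Hess u|² + 2 g⁻¹(du, dΔu) + 2 Ric(∇u, ∇u)`), the trace Cauchy–Schwarz inequality
`(Δu)² ≤ m |Hess u|²` (`trace_sq_le_finrank_mul_normSq`) and `Ric ≥ K g`:

  `Δ|∇u|² ≥ (2/m)(Δu)² + 2 g⁻¹(du, dΔu) + 2K |∇u|²`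

(Petersen 2016, Lemma 8.2.1 / Schoen–Yau, Ch. I §3; the starting point of the Cheng–Yau and
Li–Yau gradient estimates and of Cheeger–Colding's Hessian estimates, CC96 §1, §6), with the
corollary `Δ|∇u|² ≥ 2|Hess u|² + 2K|∇u|² ≥ 2K|∇u|²` at points where `dΔu = 0` (e.g. `u`
harmonic near the point). We PROVE these; no definitions, no named facts (D-0026).
Groundwork for `CheegerColding1997_sphereStability`.

## References

* P. Petersen, *Riemannian Geometry*, 3rd ed. (2016), Lemma 8.2.1. [Petersen2016]
* J. Cheeger, T. H. Colding, Ann. of Math. 144 (1996), §1. [CheegerColding1996]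
-/

noncomputable section

open Bundle Set Function
open scoped Manifold ContDiff

namespace Literature.Geometry.Riemannian

open Lorentzian Lorentzian.PseudoRiemannianMetric

variable {E : Type*} [NormedAddCommGroup E] [NormedSpace ℝ E] [FiniteDimensional ℝ E]
  {H : Type*} [TopologicalSpace H] {I : ModelWithCorners ℝ E H} [I.Boundaryless]
  {M : Type*} [TopologicalSpace M] [ChartedSpace H M] [IsManifold I ∞ M]
  (g : PseudoRiemannianMetric I ∞ E (TangentSpace I : M → Type _)) [g.HasLeviCivita]

/-- **The Bochner inequality under `Ric ≥ K g`** (Petersen 2016, Lemma 8.2.1): for a Riemannian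
`g` with `Ric ≥ K g`, a `C^∞` function `u` and every `x`,
`Δ|∇u|²(x) ≥ (2/m)(Δu(x))² + 2 g⁻¹(du, d(Δu))(x) + 2K|∇u|²(x)`, `m = dim M`.
[cite: Petersen2016, Lemma 8.2.1] [cite: CheegerColding1996, §1] -/
theorem dalembertian_gradSq_ge_of_ricci_ge (hg : g.IsRiemannian) {K : ℝ}
    (hRic : ∀ (x : M) (w : TangentSpace I x), K * g.val x w w ≤ g.ricci x w w)
    {u : M → ℝ} (hu : ContMDiff I 𝓘(ℝ, ℝ) ∞ u) (x : M) :
    2 / (Module.finrank ℝ E : ℝ) * g.dalembertian u x ^ 2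
      + 2 * g.innerDual x (mvfderiv I u x : TangentSpace I x →ₗ[ℝ] ℝ)
          (mvfderiv I (g.dalembertian u) x : TangentSpace I x →ₗ[ℝ] ℝ)
      + 2 * K * g.gradSq u x ≤ g.dalembertian (g.gradSq u) x := by
  rw [dalembertian_gradSq_eq g hu x]
  -- the Ricci term
  have hR : K * g.gradSq u x ≤ g.ricci x (g.sharp x (mvfderiv I u x : TangentSpace I x →ₗ[ℝ] ℝ))
      (g.sharp x (mvfderiv I u x : TangentSpace I x →ₗ[ℝ] ℝ)) := by
    have h := hRic x (g.sharp x (mvfderiv I u x : TangentSpace I x →ₗ[ℝ] ℝ))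
    rwa [← innerDual_eq_val_sharp_sharp] at h
  -- the Hessian term: `(Δu)² ≤ m |Hess u|²`
  have hCS := g.trace_sq_le_finrank_mul_normSq x hg (g.hessian u x)
  have hΔ : g.dalembertian u x = g.trace x (g.hessian u x) := rfl
  rw [← hΔ] at hCS
  rcases Nat.eq_zero_or_pos (Module.finrank ℝ E) with h0 | hpos
  · -- zero-dimensional: all terms vanish suitably
    rw [h0, Nat.cast_zero, div_zero, zero_mul, zero_add]
    have hH : 0 ≤ g.normSq x (g.hessian u x) := by
      rw [h0, Nat.cast_zero, zero_mul] at hCS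
      have : g.dalembertian u x ^ 2 = 0 := le_antisymm hCS (sq_nonneg _)
      -- `normSq ≥ 0` for a Riemannian metric
      exact g.normSq_nonneg x hg _
    nlinarith
  · have hm : (0 : ℝ) < Module.finrank ℝ E := by exact_mod_cast hpos
    have hH : 2 / (Module.finrank ℝ E : ℝ) * g.dalembertian u x ^ 2 ≤ 2 * g.normSq x (g.hessian u x) := by
      rw [div_mul_eq_mul_div, div_le_iff₀ hm]; nlinarith
    nlinarith


/-- **Bochner inequality at a point where `d(Δu) = 0`** (e.g. `u` harmonic near `x`):
`Δ|∇u|²(x) ≥ 2|Hess u|²(x) + 2K|∇u|²(x)` under `Ric ≥ K g`.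
[cite: Petersen2016, Lemma 8.2.1] [cite: CheegerColding1996, §1] -/
theorem dalembertian_gradSq_ge_hessian_of_mvfderiv_dalembertian_eq_zero {K : ℝ}
    (hRic : ∀ (x : M) (w : TangentSpace I x), K * g.val x w w ≤ g.ricci x w w)
    {u : M → ℝ} (hu : ContMDiff I 𝓘(ℝ, ℝ) ∞ u) {x : M}
    (hx : mvfderiv I (g.dalembertian u) x = 0) :
    2 * g.normSq x (g.hessian u x) + 2 * K * g.gradSq u x ≤ g.dalembertian (g.gradSq u) x := by
  rw [dalembertian_gradSq_eq g hu x, hx]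
  have hR : K * g.gradSq u x ≤ g.ricci x (g.sharp x (mvfderiv I u x : TangentSpace I x →ₗ[ℝ] ℝ))
      (g.sharp x (mvfderiv I u x : TangentSpace I x →ₗ[ℝ] ℝ)) := by
    have h := hRic x (g.sharp x (mvfderiv I u x : TangentSpace I x →ₗ[ℝ] ℝ))
    rwa [← innerDual_eq_val_sharp_sharp] at h
  have h0 : g.innerDual x (mvfderiv I u x : TangentSpace I x →ₗ[ℝ] ℝ)
      ((0 : TangentSpace I x →L[ℝ] ℝ) : TangentSpace I x →ₗ[ℝ] ℝ) = 0 := by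
    rw [innerDual_eq_val_sharp_sharp, ContinuousLinearMap.toLinearMap_zero, map_zero, map_zero]
  rw [h0, mul_zero, add_zero]
  linarith

/-- **`|∇u|²` is subharmonic up to the Ricci term at critical points of `Δu`**:
`Δ|∇u|²(x) ≥ 2K|∇u|²(x)` under `Ric ≥ K g` wherever `d(Δu)(x) = 0` (Riemannian `g`,
`|Hess u|² ≥ 0`); in particular `Δ|∇u|² ≥ 0` for harmonic `u` under `Ric ≥ 0`.
[cite: Petersen2016, Lemma 8.2.1] -/
theorem dalembertian_gradSq_ge_of_mvfderiv_dalembertian_eq_zero (hg : g.IsRiemannian) {K : ℝ}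
    (hRic : ∀ (x : M) (w : TangentSpace I x), K * g.val x w w ≤ g.ricci x w w)
    {u : M → ℝ} (hu : ContMDiff I 𝓘(ℝ, ℝ) ∞ u) {x : M}
    (hx : mvfderiv I (g.dalembertian u) x = 0) :
    2 * K * g.gradSq u x ≤ g.dalembertian (g.gradSq u) x := by
  have h := dalembertian_gradSq_ge_hessian_of_mvfderiv_dalembertian_eq_zero g hRic hu hx
  have hH := g.normSq_nonneg x hg (g.hessian u x)
  linarith

omit [FiniteDimensional ℝ E] [I.Boundaryless] in
/-- The hypothesis `Ric ≥ K g` in the Levi-Civita spelling used by the comparison files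
(`g.leviCivita.ricci`, e.g. `K = -(m-1)κ²`) is the same statement. [folklore] -/
theorem ricci_ge_iff_leviCivita_ricci_ge {K : ℝ} :
    (∀ (x : M) (w : TangentSpace I x), K * g.val x w w ≤ g.ricci x w w) ↔
      ∀ (x : M) (w : TangentSpace I x), K * g.val x w w ≤ g.leviCivita.ricci x w w :=
  Iff.rfl

end Literature.Geometry.Riemannian

end
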